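import Mathlib.Analysis.Calculus.FDeriv.Symmetric
import Mathlib.Analysis.Calculus.MeanValue
import Literature.Analysis.FunctionSpaces.SmoothParametricIntegral
import Literature.Geometry.Symplectic.SteinLiouvilleField
import HarnessLib

/-!
# Periods of a closed `1`-form along a smooth family of loops are constant

Topic `Literature/Geometry/Symplectic`; proofs file (layer "wrapping number", continued) of the
fact seat of `Literature.Geometry.Symplectic.mclean_divisorComplement_convex_four` (M. McLean,
*The growth rate of symplectic homology and affine varieties*, GAFA 22 (2012), Lemma 5.17).
McLean's wrapping number `κᵢ` (p. 36 of arXiv:1011.2542v3) is a period of the closed form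
`θ - (r²/2) dϑ` over a small meridian circle, and its independence of the chosen disc is the
sentence "Because `Sᵢ ∖ ∪_{j ≠ i} S_j` is connected, there is a smooth family `W_t` joining `W'`
and `W`.  Hence the constant `κᵢ` associated to `W'` is the same as the constant `κᵢ` associated
to `W`" — the **homotopy invariance of the periods of a closed `1`-form** (Bott–Tu 1982, §I.4,
Cor. 4.1.2 / Lee 2013, Prop. 16.26 and Thm. 17.16 region).

This file proves the flat, calculus form of that statement for Mathlib's `extDeriv`: if
`β : E → E [⋀^Fin 1]→L[ℝ] ℝ` is `C^∞` and closed on an open set `O` of a real normed space `E`,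
and `Γ : ℝ × ℝ → E` is a `C^∞` family of loops in `O` (`Γ (a, s) = Γ (b, s)` for all `s`; the
loop parameter is the first variable), then the period

  `I(s) = ∫ₐᵇ β_{Γ(t,s)} (∂ₜ Γ (t, s)) dt`

does not depend on `s` (`loopPeriod_eq_of_closed`).  Proof (the classical computation):
differentiate under the integral sign (the tree's `fderiv_parametric_intervalIntegral_apply`),
`∂ₛ [β_Γ(∂ₜΓ)] - ∂ₜ [β_Γ(∂ₛΓ)] = dβ_Γ(∂ₛΓ, ∂ₜΓ) + β_Γ(∂ₛ∂ₜΓ - ∂ₜ∂ₛΓ) = 0` (closedness, and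
symmetry of second derivatives, `ContDiffAt.isSymmSndFDerivAt`), so
`I'(s) = ∫ₐᵇ ∂ₜ [β_Γ(∂ₛΓ)] dt = [β_Γ(∂ₛΓ)]ₐᵇ = 0` because the loops are closed.

The last section drops the closedness assumption: the **first variation formula**
`d/ds ∫ₐᵇ β_Γ(∂ₜΓ) dt = ∫ₐᵇ dβ_Γ(∂ₛΓ, ∂ₜΓ) dt` (`hasDerivAt_loopIntegral`), which for a
primitive `θ` of a symplectic form is the flux of `ω` through the family of loops.

Everything is proved; no definitions, no named facts (D-0026).

## References

* M. McLean, *The growth rate of symplectic homology and affine varieties*, Geom. Funct. Anal. 22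
  (2012), p. 36 (invariance of the wrapping number). [Mclean2012]
* R. Bott, L. W. Tu, *Differential Forms in Algebraic Topology*, GTM 82 (1982), §I.4.
  [BottTu1982Forms]
-/

noncomputable section

open scoped Topology ContDiff
open Set Filter ContinuousAlternatingMap MeasureTheory intervalIntegral

namespace Literature.Geometry.Symplectic

variable {E : Type*} [NormedAddCommGroup E] [NormedSpace ℝ E]

/-! ### Pointwise calculus -/

/-- **`d` of a `1`-form on two vectors in terms of the derivative**:
`dβ_y(u, v) = (Dβ_y u)(v) - (Dβ_y v)(u)` (Mathlib's normalisation of `extDeriv`). [folklore] -/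
theorem extDeriv_apply_vecCons_two {β : E → E [⋀^Fin 1]→L[ℝ] ℝ} {y : E}
    (hβ : DifferentiableAt ℝ β y) (u v : E) :
    extDeriv β y ![u, v] = (fderiv ℝ β y u) ![v] - (fderiv ℝ β y v) ![u] := by
  rw [extDeriv_apply hβ, Fin.sum_univ_two]
  have h0 : Fin.removeNth (0 : Fin 2) ![u, v] = ![v] := by
    funext i; fin_cases i; rfl
  have h1 : Fin.removeNth (1 : Fin 2) ![u, v] = ![u] := by
    funext i; fin_cases i; rfl
  simp only [h0, h1, Fin.val_zero, Fin.val_one, pow_zero, pow_one, one_smul, neg_smul,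
    Matrix.cons_val_zero, Matrix.cons_val_one, sub_eq_add_neg,
    fderiv_continuousAlternatingMap_apply_const_apply hβ]

/-- Directional derivative of a fixed directional derivative: for `Γ` twice differentiable,
`D(y ↦ DΓ_y v)(x) h = D²Γ_x h v`. [folklore] -/
theorem fderiv_fderiv_apply_const {G : Type*} [NormedAddCommGroup G] [NormedSpace ℝ G]
    {Γ : G → E} {x : G} (hΓ : DifferentiableAt ℝ (fderiv ℝ Γ) x) (v h : G) :
    fderiv ℝ (fun y ↦ fderiv ℝ Γ y v) x h = fderiv ℝ (fderiv ℝ Γ) x h v := by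
  rw [fderiv_clm_apply hΓ (differentiableAt_const v)]
  simp

/-! ### The variation of the period -/

section Variation

variable {β : E → E [⋀^Fin 1]→L[ℝ] ℝ} {O : Set E} {Γ : ℝ × ℝ → E}

/-- **The key pointwise identity** `∂ₛ [β_Γ(∂ₜΓ)] = ∂ₜ [β_Γ(∂ₛΓ)]` for a closed `β` and a `C^∞`
map `Γ` (loop parameter `t` = first variable, family parameter `s` = second): the difference is
`dβ_Γ(∂ₛΓ, ∂ₜΓ) + β_Γ(∂ₛ∂ₜΓ - ∂ₜ∂ₛΓ) = 0`. [cite: BottTu1982Forms, §I.4] -/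
theorem fderiv_pairing_dt_ds_eq (hO : IsOpen O) (hβ : ContDiffOn ℝ ∞ β O)
    (hd : ∀ y ∈ O, extDeriv β y = 0) (hΓ : ContDiff ℝ ∞ Γ) (hΓO : ∀ x, Γ x ∈ O) (x : ℝ × ℝ) :
    fderiv ℝ (fun y ↦ β (Γ y) ![fderiv ℝ Γ y (1, 0)]) x (0, 1) =
      fderiv ℝ (fun y ↦ β (Γ y) ![fderiv ℝ Γ y (0, 1)]) x (1, 0) := by
  -- smoothness facts at `x`
  have hβx : ContDiffAt ℝ ∞ β (Γ x) := hβ.contDiffAt (hO.mem_nhds (hΓO x))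
  have hBx : ContDiffAt ℝ ∞ (fun y ↦ β (Γ y)) x := hβx.comp x hΓ.contDiffAt
  have hB : HasFDerivAt (fun y ↦ β (Γ y)) ((fderiv ℝ β (Γ x)).comp (fderiv ℝ Γ x)) x :=
    (hβx.differentiableAt (by simp)).hasFDerivAt.comp x
      (hΓ.contDiffAt.differentiableAt (by simp)).hasFDerivAt
  have hC : HasFDerivAt (fun y ↦ alt1ToCLM (β (Γ y)))
      ((alt1ToCLM (E := E)).comp ((fderiv ℝ β (Γ x)).comp (fderiv ℝ Γ x))) x :=
    (alt1ToCLM (E := E)).hasFDerivAt.comp x hB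
  have hDΓ : DifferentiableAt ℝ (fderiv ℝ Γ) x :=
    ((hΓ.fderiv_right (m := ∞) (by simp)).differentiable (by simp)) x
  have hV : ∀ v : ℝ × ℝ, HasFDerivAt (fun y ↦ fderiv ℝ Γ y v)
      ((fderiv ℝ (fderiv ℝ Γ) x).flip v) x := fun v ↦ by
    have h := hDΓ.hasFDerivAt.clm_apply (hasFDerivAt_const v x)
    simpa using h
  -- the two derivatives, by the Leibniz rule for `(C y) (V y)`
  have hrw : ∀ v : ℝ × ℝ, (fun y ↦ β (Γ y) ![fderiv ℝ Γ y v]) =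
      fun y ↦ alt1ToCLM (β (Γ y)) (fderiv ℝ Γ y v) := fun v ↦ by
    funext y; rw [alt1ToCLM_apply]
  rw [hrw (1, 0), hrw (0, 1), (hC.clm_apply (hV (1, 0))).fderiv, (hC.clm_apply (hV (0, 1))).fderiv]
  simp only [_root_.add_apply, ContinuousLinearMap.comp_apply, ContinuousLinearMap.flip_apply,
    alt1ToCLM_apply]
  -- symmetry of second derivatives and closedness
  have h2 : minSmoothness ℝ 2 ≤ ∞ := by
    rw [minSmoothness_of_isRCLikeNormedField]
    exact WithTop.coe_le_coe.2 le_top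
  have hsymm : fderiv ℝ (fderiv ℝ Γ) x (0, 1) (1, 0) = fderiv ℝ (fderiv ℝ Γ) x (1, 0) (0, 1) :=
    (hΓ.contDiffAt.isSymmSndFDerivAt h2) (0, 1) (1, 0)
  have hclosed := extDeriv_apply_vecCons_two (hβx.differentiableAt (by simp))
    (fderiv ℝ Γ x (0, 1)) (fderiv ℝ Γ x (1, 0))
  rw [hd _ (hΓO x)] at hclosed
  have hclosed' : (fderiv ℝ β (Γ x) (fderiv ℝ Γ x (0, 1))) ![fderiv ℝ Γ x (1, 0)] -
      (fderiv ℝ β (Γ x) (fderiv ℝ Γ x (1, 0))) ![fderiv ℝ Γ x (0, 1)] = 0 := by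
    rw [← hclosed]
    rfl
  rw [hsymm]
  linarith

/-- The integrand of the period, `(t, s) ↦ β_{Γ(t,s)}(∂ₜΓ(t,s))`, and the boundary pairing
`(t, s) ↦ β_{Γ(t,s)}(∂ₛΓ(t,s))` are `C^∞`. [folklore] -/
theorem contDiff_pairing (hO : IsOpen O) (hβ : ContDiffOn ℝ ∞ β O) (hΓ : ContDiff ℝ ∞ Γ)
    (hΓO : ∀ x, Γ x ∈ O) (v : ℝ × ℝ) :
    ContDiff ℝ ∞ fun y ↦ β (Γ y) ![fderiv ℝ Γ y v] := by
  have hB : ContDiff ℝ ∞ fun y ↦ β (Γ y) := contDiff_iff_contDiffAt.2 fun x ↦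
    (hβ.contDiffAt (hO.mem_nhds (hΓO x))).comp x hΓ.contDiffAt
  have hC : ContDiff ℝ ∞ fun y ↦ alt1ToCLM (β (Γ y)) := (alt1ToCLM (E := E)).contDiff.comp hB
  have hV : ContDiff ℝ ∞ fun y ↦ fderiv ℝ Γ y v :=
    (hΓ.fderiv_right (m := ∞) (by simp)).clm_apply contDiff_const
  have hfun : (fun y ↦ β (Γ y) ![fderiv ℝ Γ y v]) =
      fun y ↦ alt1ToCLM (β (Γ y)) (fderiv ℝ Γ y v) := by
    funext y; rw [alt1ToCLM_apply]
  rw [hfun]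
  exact hC.clm_apply hV

/-- **The derivative of the period vanishes**: for `I(s) = ∫ₐᵇ β_{Γ(t,s)}(∂ₜΓ) dt` with closed
loops `Γ(a, s) = Γ(b, s)`, `I'(s) = [β_Γ(∂ₛΓ)]ₐᵇ = 0`. [cite: BottTu1982Forms, §I.4] -/
theorem hasDerivAt_loopPeriod_zero (hO : IsOpen O) (hβ : ContDiffOn ℝ ∞ β O)
    (hd : ∀ y ∈ O, extDeriv β y = 0) (hΓ : ContDiff ℝ ∞ Γ) (hΓO : ∀ x, Γ x ∈ O) {a b : ℝ}
    (hloop : ∀ s, Γ (a, s) = Γ (b, s)) (s : ℝ) :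
    HasDerivAt (fun s ↦ ∫ t in a..b, β (Γ (t, s)) ![fderiv ℝ Γ (t, s) (1, 0)]) 0 s := by
  set H : ℝ × ℝ → ℝ := fun y ↦ β (Γ y) ![fderiv ℝ Γ y (1, 0)] with hH
  set G : ℝ × ℝ → ℝ := fun y ↦ β (Γ y) ![fderiv ℝ Γ y (0, 1)] with hG
  have hHs : ContDiff ℝ ∞ H := contDiff_pairing hO hβ hΓ hΓO (1, 0)
  have hGs : ContDiff ℝ ∞ G := contDiff_pairing hO hβ hΓ hΓO (0, 1)
  -- differentiate under the integral sign
  have hI : HasFDerivAt (fun p : ℝ ↦ ∫ t in a..b, H (t, p))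
      (∫ t in a..b, (fderiv ℝ H (t, s)).comp (ContinuousLinearMap.inr ℝ ℝ ℝ)) s :=
    Literature.Analysis.FunctionSpaces.hasFDerivAt_parametric_intervalIntegral hHs (by simp) a b s
  have hI' : HasDerivAt (fun p : ℝ ↦ ∫ t in a..b, H (t, p))
      ((∫ t in a..b, (fderiv ℝ H (t, s)).comp (ContinuousLinearMap.inr ℝ ℝ ℝ)) 1) s :=
    hI.hasDerivAt
  have hval : (∫ t in a..b, (fderiv ℝ H (t, s)).comp (ContinuousLinearMap.inr ℝ ℝ ℝ)) (1 : ℝ) =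
      ∫ t in a..b, fderiv ℝ H (t, s) ((0 : ℝ), (1 : ℝ)) := by
    rw [← (hI.fderiv),
      Literature.Analysis.FunctionSpaces.fderiv_parametric_intervalIntegral_apply hHs (by simp)
        a b s 1]
  rw [hval] at hI'
  -- the integrand of `I'` is `∂ₜ G`
  have hswap : ∀ t, fderiv ℝ H (t, s) ((0 : ℝ), (1 : ℝ)) = fderiv ℝ G (t, s) ((1 : ℝ), (0 : ℝ)) :=
    fun t ↦ fderiv_pairing_dt_ds_eq hO hβ hd hΓ hΓO (t, s)
  have hGt : ∀ t, HasDerivAt (fun t ↦ G (t, s)) (fderiv ℝ G (t, s) ((1 : ℝ), (0 : ℝ))) t := by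
    intro t
    have h1 : HasFDerivAt G (fderiv ℝ G (t, s)) (t, s) :=
      ((hGs.differentiable (by simp)) (t, s)).hasFDerivAt
    have h2 : HasDerivAt (fun t : ℝ ↦ ((t, s) : ℝ × ℝ)) ((1 : ℝ), (0 : ℝ)) t := by
      have := (hasDerivAt_id t).prodMk (hasDerivAt_const t s)
      simpa using this
    exact h1.comp_hasDerivAt t h2
  have hcont : Continuous fun t ↦ fderiv ℝ G (t, s) ((1 : ℝ), (0 : ℝ)) :=
    ((hGs.continuous_fderiv (by simp)).comp (continuous_id.prodMk continuous_const)).clm_apply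
      continuous_const
  have hFTC : ∫ t in a..b, fderiv ℝ G (t, s) ((1 : ℝ), (0 : ℝ)) = G (b, s) - G (a, s) :=
    integral_eq_sub_of_hasDerivAt (fun t _ ↦ hGt t) (hcont.intervalIntegrable _ _)
  -- the boundary term vanishes because the loops are closed
  have hends : G (b, s) = G (a, s) := by
    have hfun : (fun s ↦ Γ (a, s)) = fun s ↦ Γ (b, s) := funext hloop
    have hda : fderiv ℝ Γ (a, s) ((0 : ℝ), (1 : ℝ)) = deriv (fun s ↦ Γ (a, s)) s := by
      have h2 : HasDerivAt (fun s : ℝ ↦ ((a, s) : ℝ × ℝ)) ((0 : ℝ), (1 : ℝ)) s := by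
        simpa using (hasDerivAt_const s a).prodMk (hasDerivAt_id s)
      exact ((((hΓ.differentiable (by simp)) (a, s)).hasFDerivAt.comp_hasDerivAt s h2).deriv).symm
    have hdb : fderiv ℝ Γ (b, s) ((0 : ℝ), (1 : ℝ)) = deriv (fun s ↦ Γ (b, s)) s := by
      have h2 : HasDerivAt (fun s : ℝ ↦ ((b, s) : ℝ × ℝ)) ((0 : ℝ), (1 : ℝ)) s := by
        simpa using (hasDerivAt_const s b).prodMk (hasDerivAt_id s)
      exact ((((hΓ.differentiable (by simp)) (b, s)).hasFDerivAt.comp_hasDerivAt s h2).deriv).symm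
    simp only [hG, hda, hdb, hfun, hloop s]
  have hzero : ∫ t in a..b, fderiv ℝ H (t, s) ((0 : ℝ), (1 : ℝ)) = 0 := by
    simp_rw [hswap]
    rw [hFTC, hends, sub_self]
  rwa [hzero] at hI'

/-- **Periods of a closed `1`-form along a smooth family of loops are constant** (homotopy
invariance of periods; Bott–Tu 1982, §I.4; McLean 2012, p. 36: "Hence the constant `κᵢ`
associated to `W'` is the same as the constant `κᵢ` associated to `W`").  For `β` smooth and
closed on an open `O ⊆ E` and a `C^∞` family `Γ : ℝ × ℝ → O` of closed loops
(`Γ (a, s) = Γ (b, s)`), the period `∫ₐᵇ β_{Γ(t,s)}(∂ₜΓ(t,s)) dt` is the same for all `s`.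
[cite: Mclean2012, p. 36 (wrapping number)] -/
theorem loopPeriod_eq_of_closed (hO : IsOpen O) (hβ : ContDiffOn ℝ ∞ β O)
    (hd : ∀ y ∈ O, extDeriv β y = 0) (hΓ : ContDiff ℝ ∞ Γ) (hΓO : ∀ x, Γ x ∈ O) {a b : ℝ}
    (hloop : ∀ s, Γ (a, s) = Γ (b, s)) (s₁ s₂ : ℝ) :
    ∫ t in a..b, β (Γ (t, s₁)) ![fderiv ℝ Γ (t, s₁) (1, 0)] =
      ∫ t in a..b, β (Γ (t, s₂)) ![fderiv ℝ Γ (t, s₂) (1, 0)] := by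
  have hD : ∀ s, HasDerivAt (fun s ↦ ∫ t in a..b, β (Γ (t, s)) ![fderiv ℝ Γ (t, s) (1, 0)]) 0 s :=
    fun s ↦ hasDerivAt_loopPeriod_zero hO hβ hd hΓ hΓO hloop s
  exact is_const_of_deriv_eq_zero (fun s ↦ (hD s).differentiableAt) (fun s ↦ (hD s).deriv) s₁ s₂

end Variation

/-! ### The first variation of a loop integral (general `1`-form)

The same computation without the closedness assumption: the **first variation formula**
`d/ds ∫ₐᵇ β_{Γ(t,s)}(∂ₜΓ) dt = ∫ₐᵇ dβ_{Γ(t,s)}(∂ₛΓ, ∂ₜΓ) dt` for a smooth family of closed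
loops (Bott–Tu 1982, §I.4; this is how McLean 2012, proof of Lemma 5.17, sees that the fibre
circle periods of a primitive `θ` of `ω` change by the `ω`-flux, `∮ ι_{∂ₛΓ} ω`). -/

section FirstVariation

variable {β : E → E [⋀^Fin 1]→L[ℝ] ℝ} {O : Set E} {Γ : ℝ × ℝ → E}

/-- **Pointwise first variation identity**: `∂ₛ [β_Γ(∂ₜΓ)] - ∂ₜ [β_Γ(∂ₛΓ)] = dβ_Γ(∂ₛΓ, ∂ₜΓ)`
for a `C^∞` form `β` on an open set containing the image of the `C^∞` map `Γ` (loop parameter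
`t` = first variable, family parameter `s` = second; the terms `β_Γ(∂ₛ∂ₜΓ)` cancel by symmetry
of second derivatives). [cite: BottTu1982Forms, §I.4] -/
theorem fderiv_pairing_dt_ds_sub (hO : IsOpen O) (hβ : ContDiffOn ℝ ∞ β O)
    (hΓ : ContDiff ℝ ∞ Γ) (hΓO : ∀ x, Γ x ∈ O) (x : ℝ × ℝ) :
    fderiv ℝ (fun y ↦ β (Γ y) ![fderiv ℝ Γ y (1, 0)]) x (0, 1) -
        fderiv ℝ (fun y ↦ β (Γ y) ![fderiv ℝ Γ y (0, 1)]) x (1, 0) =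
      extDeriv β (Γ x) ![fderiv ℝ Γ x (0, 1), fderiv ℝ Γ x (1, 0)] := by
  have hβx : ContDiffAt ℝ ∞ β (Γ x) := hβ.contDiffAt (hO.mem_nhds (hΓO x))
  have hB : HasFDerivAt (fun y ↦ β (Γ y)) ((fderiv ℝ β (Γ x)).comp (fderiv ℝ Γ x)) x :=
    (hβx.differentiableAt (by simp)).hasFDerivAt.comp x
      (hΓ.contDiffAt.differentiableAt (by simp)).hasFDerivAt
  have hC : HasFDerivAt (fun y ↦ alt1ToCLM (β (Γ y)))
      ((alt1ToCLM (E := E)).comp ((fderiv ℝ β (Γ x)).comp (fderiv ℝ Γ x))) x :=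
    (alt1ToCLM (E := E)).hasFDerivAt.comp x hB
  have hDΓ : DifferentiableAt ℝ (fderiv ℝ Γ) x :=
    ((hΓ.fderiv_right (m := ∞) (by simp)).differentiable (by simp)) x
  have hV : ∀ v : ℝ × ℝ, HasFDerivAt (fun y ↦ fderiv ℝ Γ y v)
      ((fderiv ℝ (fderiv ℝ Γ) x).flip v) x := fun v ↦ by
    have h := hDΓ.hasFDerivAt.clm_apply (hasFDerivAt_const v x)
    simpa using h
  have hrw : ∀ v : ℝ × ℝ, (fun y ↦ β (Γ y) ![fderiv ℝ Γ y v]) =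
      fun y ↦ alt1ToCLM (β (Γ y)) (fderiv ℝ Γ y v) := fun v ↦ by
    funext y; rw [alt1ToCLM_apply]
  rw [hrw (1, 0), hrw (0, 1), (hC.clm_apply (hV (1, 0))).fderiv, (hC.clm_apply (hV (0, 1))).fderiv]
  simp only [_root_.add_apply, ContinuousLinearMap.comp_apply, ContinuousLinearMap.flip_apply,
    alt1ToCLM_apply]
  have h2 : minSmoothness ℝ 2 ≤ ∞ := by
    rw [minSmoothness_of_isRCLikeNormedField]
    exact WithTop.coe_le_coe.2 le_top
  have hsymm : fderiv ℝ (fderiv ℝ Γ) x (0, 1) (1, 0) = fderiv ℝ (fderiv ℝ Γ) x (1, 0) (0, 1) :=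
    (hΓ.contDiffAt.isSymmSndFDerivAt h2) (0, 1) (1, 0)
  rw [extDeriv_apply_vecCons_two (hβx.differentiableAt (by simp)), hsymm]
  ring

/-- **First variation of a loop integral**: for a `C^∞` form `β` on an open `O ⊆ E` and a `C^∞`
family `Γ : ℝ × ℝ → O` of closed loops (`Γ (a, s) = Γ (b, s)`),
`d/ds ∫ₐᵇ β_{Γ(t,s)}(∂ₜΓ(t,s)) dt = ∫ₐᵇ dβ_{Γ(t,s)}(∂ₛΓ(t,s), ∂ₜΓ(t,s)) dt`
(differentiation under the integral sign, the pointwise identity, and `[β_Γ(∂ₛΓ)]ₐᵇ = 0`).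
[cite: BottTu1982Forms, §I.4] -/
theorem hasDerivAt_loopIntegral (hO : IsOpen O) (hβ : ContDiffOn ℝ ∞ β O)
    (hΓ : ContDiff ℝ ∞ Γ) (hΓO : ∀ x, Γ x ∈ O) {a b : ℝ} (hloop : ∀ s, Γ (a, s) = Γ (b, s))
    (s : ℝ) :
    HasDerivAt (fun s ↦ ∫ t in a..b, β (Γ (t, s)) ![fderiv ℝ Γ (t, s) (1, 0)])
      (∫ t in a..b,
        extDeriv β (Γ (t, s)) ![fderiv ℝ Γ (t, s) (0, 1), fderiv ℝ Γ (t, s) (1, 0)]) s := by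
  set H : ℝ × ℝ → ℝ := fun y ↦ β (Γ y) ![fderiv ℝ Γ y (1, 0)] with hH
  set G : ℝ × ℝ → ℝ := fun y ↦ β (Γ y) ![fderiv ℝ Γ y (0, 1)] with hG
  set D : ℝ → ℝ := fun t ↦
    extDeriv β (Γ (t, s)) ![fderiv ℝ Γ (t, s) (0, 1), fderiv ℝ Γ (t, s) (1, 0)] with hDdef
  have hHs : ContDiff ℝ ∞ H := contDiff_pairing hO hβ hΓ hΓO (1, 0)
  have hGs : ContDiff ℝ ∞ G := contDiff_pairing hO hβ hΓ hΓO (0, 1)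
  -- differentiate under the integral sign
  have hI : HasFDerivAt (fun p : ℝ ↦ ∫ t in a..b, H (t, p))
      (∫ t in a..b, (fderiv ℝ H (t, s)).comp (ContinuousLinearMap.inr ℝ ℝ ℝ)) s :=
    Literature.Analysis.FunctionSpaces.hasFDerivAt_parametric_intervalIntegral hHs (by simp) a b s
  have hI' : HasDerivAt (fun p : ℝ ↦ ∫ t in a..b, H (t, p))
      ((∫ t in a..b, (fderiv ℝ H (t, s)).comp (ContinuousLinearMap.inr ℝ ℝ ℝ)) 1) s :=
    hI.hasDerivAt
  have hval : (∫ t in a..b, (fderiv ℝ H (t, s)).comp (ContinuousLinearMap.inr ℝ ℝ ℝ)) (1 : ℝ) =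
      ∫ t in a..b, fderiv ℝ H (t, s) ((0 : ℝ), (1 : ℝ)) := by
    rw [← (hI.fderiv),
      Literature.Analysis.FunctionSpaces.fderiv_parametric_intervalIntegral_apply hHs (by simp)
        a b s 1]
  rw [hval] at hI'
  -- the integrand of the derivative is `∂ₜ G + D`
  have hswap : ∀ t, fderiv ℝ H (t, s) ((0 : ℝ), (1 : ℝ)) =
      fderiv ℝ G (t, s) ((1 : ℝ), (0 : ℝ)) + D t := fun t ↦ by
    have h := fderiv_pairing_dt_ds_sub hO hβ hΓ hΓO (t, s)
    simp only [hDdef]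
    linarith
  have hHc : Continuous fun t ↦ fderiv ℝ H (t, s) ((0 : ℝ), (1 : ℝ)) :=
    ((hHs.continuous_fderiv (by simp)).comp (continuous_id.prodMk continuous_const)).clm_apply
      continuous_const
  have hGc : Continuous fun t ↦ fderiv ℝ G (t, s) ((1 : ℝ), (0 : ℝ)) :=
    ((hGs.continuous_fderiv (by simp)).comp (continuous_id.prodMk continuous_const)).clm_apply
      continuous_const
  have hDc : Continuous D := by
    have hfun : D = fun t ↦ fderiv ℝ H (t, s) ((0 : ℝ), (1 : ℝ)) -
        fderiv ℝ G (t, s) ((1 : ℝ), (0 : ℝ)) := by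
      funext t; rw [hswap t]; ring
    rw [hfun]
    exact hHc.sub hGc
  have hGt : ∀ t, HasDerivAt (fun t ↦ G (t, s)) (fderiv ℝ G (t, s) ((1 : ℝ), (0 : ℝ))) t := by
    intro t
    have h1 : HasFDerivAt G (fderiv ℝ G (t, s)) (t, s) :=
      ((hGs.differentiable (by simp)) (t, s)).hasFDerivAt
    have h2 : HasDerivAt (fun t : ℝ ↦ ((t, s) : ℝ × ℝ)) ((1 : ℝ), (0 : ℝ)) t := by
      have := (hasDerivAt_id t).prodMk (hasDerivAt_const t s)
      simpa using this
    exact h1.comp_hasDerivAt t h2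
  have hFTC : ∫ t in a..b, fderiv ℝ G (t, s) ((1 : ℝ), (0 : ℝ)) = G (b, s) - G (a, s) :=
    integral_eq_sub_of_hasDerivAt (fun t _ ↦ hGt t) (hGc.intervalIntegrable _ _)
  have hends : G (b, s) = G (a, s) := by
    have hfun : (fun s ↦ Γ (a, s)) = fun s ↦ Γ (b, s) := funext hloop
    have hda : fderiv ℝ Γ (a, s) ((0 : ℝ), (1 : ℝ)) = deriv (fun s ↦ Γ (a, s)) s := by
      have h2 : HasDerivAt (fun s : ℝ ↦ ((a, s) : ℝ × ℝ)) ((0 : ℝ), (1 : ℝ)) s := by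
        simpa using (hasDerivAt_const s a).prodMk (hasDerivAt_id s)
      exact ((((hΓ.differentiable (by simp)) (a, s)).hasFDerivAt.comp_hasDerivAt s h2).deriv).symm
    have hdb : fderiv ℝ Γ (b, s) ((0 : ℝ), (1 : ℝ)) = deriv (fun s ↦ Γ (b, s)) s := by
      have h2 : HasDerivAt (fun s : ℝ ↦ ((b, s) : ℝ × ℝ)) ((0 : ℝ), (1 : ℝ)) s := by
        simpa using (hasDerivAt_const s b).prodMk (hasDerivAt_id s)
      exact ((((hΓ.differentiable (by simp)) (b, s)).hasFDerivAt.comp_hasDerivAt s h2).deriv).symm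
    simp only [hG, hda, hdb, hfun, hloop s]
  have hcalc : ∫ t in a..b, fderiv ℝ H (t, s) ((0 : ℝ), (1 : ℝ)) = ∫ t in a..b, D t := by
    simp_rw [hswap]
    rw [intervalIntegral.integral_add (hGc.intervalIntegrable _ _) (hDc.intervalIntegrable _ _),
      hFTC, hends, sub_self, zero_add]
  rwa [hcalc] at hI'

/-- **First variation with matching ends** (the form needed for `2π`-PERIODIC families, e.g.
the unrolled orbits `t ↦ (u, t)` of a circle action in a flat slice model, where the loops close
up only modulo the period): the conclusion of `hasDerivAt_loopIntegral` holds as soon as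
`β(Γ(b, s)) = β(Γ(a, s))` and `∂ₛΓ(b, s) = ∂ₛΓ(a, s)` for all `s` (these are all the proof uses
of `Γ(a, s) = Γ(b, s)`). [cite: BottTu1982Forms, §I.4] -/
theorem hasDerivAt_loopIntegral_of_ends (hO : IsOpen O) (hβ : ContDiffOn ℝ ∞ β O)
    (hΓ : ContDiff ℝ ∞ Γ) (hΓO : ∀ x, Γ x ∈ O) {a b : ℝ}
    (hends : ∀ s, β (Γ (b, s)) = β (Γ (a, s)))
    (hends' : ∀ s, fderiv ℝ Γ (b, s) (0, 1) = fderiv ℝ Γ (a, s) (0, 1)) (s : ℝ) :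
    HasDerivAt (fun s ↦ ∫ t in a..b, β (Γ (t, s)) ![fderiv ℝ Γ (t, s) (1, 0)])
      (∫ t in a..b,
        extDeriv β (Γ (t, s)) ![fderiv ℝ Γ (t, s) (0, 1), fderiv ℝ Γ (t, s) (1, 0)]) s := by
  set H : ℝ × ℝ → ℝ := fun y ↦ β (Γ y) ![fderiv ℝ Γ y (1, 0)] with hH
  set G : ℝ × ℝ → ℝ := fun y ↦ β (Γ y) ![fderiv ℝ Γ y (0, 1)] with hG
  set D : ℝ → ℝ := fun t ↦
    extDeriv β (Γ (t, s)) ![fderiv ℝ Γ (t, s) (0, 1), fderiv ℝ Γ (t, s) (1, 0)] with hDdef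
  have hHs : ContDiff ℝ ∞ H := contDiff_pairing hO hβ hΓ hΓO (1, 0)
  have hGs : ContDiff ℝ ∞ G := contDiff_pairing hO hβ hΓ hΓO (0, 1)
  have hI : HasFDerivAt (fun p : ℝ ↦ ∫ t in a..b, H (t, p))
      (∫ t in a..b, (fderiv ℝ H (t, s)).comp (ContinuousLinearMap.inr ℝ ℝ ℝ)) s :=
    Literature.Analysis.FunctionSpaces.hasFDerivAt_parametric_intervalIntegral hHs (by simp) a b s
  have hI' : HasDerivAt (fun p : ℝ ↦ ∫ t in a..b, H (t, p))
      ((∫ t in a..b, (fderiv ℝ H (t, s)).comp (ContinuousLinearMap.inr ℝ ℝ ℝ)) 1) s :=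
    hI.hasDerivAt
  have hval : (∫ t in a..b, (fderiv ℝ H (t, s)).comp (ContinuousLinearMap.inr ℝ ℝ ℝ)) (1 : ℝ) =
      ∫ t in a..b, fderiv ℝ H (t, s) ((0 : ℝ), (1 : ℝ)) := by
    rw [← (hI.fderiv),
      Literature.Analysis.FunctionSpaces.fderiv_parametric_intervalIntegral_apply hHs (by simp)
        a b s 1]
  rw [hval] at hI'
  have hswap : ∀ t, fderiv ℝ H (t, s) ((0 : ℝ), (1 : ℝ)) =
      fderiv ℝ G (t, s) ((1 : ℝ), (0 : ℝ)) + D t := fun t ↦ by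
    have h := fderiv_pairing_dt_ds_sub hO hβ hΓ hΓO (t, s)
    simp only [hDdef]
    linarith
  have hHc : Continuous fun t ↦ fderiv ℝ H (t, s) ((0 : ℝ), (1 : ℝ)) :=
    ((hHs.continuous_fderiv (by simp)).comp (continuous_id.prodMk continuous_const)).clm_apply
      continuous_const
  have hGc : Continuous fun t ↦ fderiv ℝ G (t, s) ((1 : ℝ), (0 : ℝ)) :=
    ((hGs.continuous_fderiv (by simp)).comp (continuous_id.prodMk continuous_const)).clm_apply
      continuous_const
  have hDc : Continuous D := by
    have hfun : D = fun t ↦ fderiv ℝ H (t, s) ((0 : ℝ), (1 : ℝ)) -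
        fderiv ℝ G (t, s) ((1 : ℝ), (0 : ℝ)) := by
      funext t; rw [hswap t]; ring
    rw [hfun]
    exact hHc.sub hGc
  have hGt : ∀ t, HasDerivAt (fun t ↦ G (t, s)) (fderiv ℝ G (t, s) ((1 : ℝ), (0 : ℝ))) t := by
    intro t
    have h1 : HasFDerivAt G (fderiv ℝ G (t, s)) (t, s) :=
      ((hGs.differentiable (by simp)) (t, s)).hasFDerivAt
    have h2 : HasDerivAt (fun t : ℝ ↦ ((t, s) : ℝ × ℝ)) ((1 : ℝ), (0 : ℝ)) t := by
      have := (hasDerivAt_id t).prodMk (hasDerivAt_const t s)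
      simpa using this
    exact h1.comp_hasDerivAt t h2
  have hFTC : ∫ t in a..b, fderiv ℝ G (t, s) ((1 : ℝ), (0 : ℝ)) = G (b, s) - G (a, s) :=
    integral_eq_sub_of_hasDerivAt (fun t _ ↦ hGt t) (hGc.intervalIntegrable _ _)
  have hGends : G (b, s) = G (a, s) := by
    simp only [hG, hends s, hends' s]
  have hcalc : ∫ t in a..b, fderiv ℝ H (t, s) ((0 : ℝ), (1 : ℝ)) = ∫ t in a..b, D t := by
    simp_rw [hswap]
    rw [intervalIntegral.integral_add (hGc.intervalIntegrable _ _) (hDc.intervalIntegrable _ _),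
      hFTC, hGends, sub_self, zero_add]
  rwa [hcalc] at hI'

end FirstVariation

end Literature.Geometry.Symplectic
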